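import Literature.AlgebraicGeometry.Motives.GeneratingSectionsSerreTwistClass
import Literature.AlgebraicGeometry.Modules.LineBundleOfCocycleClass
import HarnessLib

/-!
# The class of `𝒪_X(-n)` along the morphism defined by COCYCLE-LEVEL sections: `[𝒪_X(-n)] = [c]^{-n}`

Layer `Literature/AlgebraicGeometry/Modules`, namespace `Literature.AlgebraicGeometry.Modules.SerreTwist`.  THEOREMS ONLY (no
definition, no named fact, no instance, no notation, no `sorry`).  Cell `hodgecm-mathlib` (D-0151), floor-0 programme P1, sub-line
F-13 (`stub_PL`, card `Lines/F13PluckerProducer.md`), inner target P3 «unit cocycle of a linear rigidification», generic lack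
LACK-B of the P3 census (the cocycle-level sibling of ★ `GeneratingSections.detClass_serreTwist_toProj`).  Count-neutral capital:
HC_CM is proved only modulo the 7 printed citations until rung 0 closes — nothing here bears on a summit statement.

[Hartshorne1977] II Thm. 7.1 describes a morphism `φ : X → ℙʳ_A` by an invertible sheaf `𝓛` and generating sections
`t₀, …, t_r`, with `φ^*𝒪(1) ≅ 𝓛`.  The tree's sheaf-free currency for «`𝓛` and its sections» is COEFFICIENT-LEVEL: a point-indexed
open cover `U_x ∋ x` with a Čech `1`-cocycle of units `c = (g_{xy})` (★ `Modules.UnitCocycle`; the transition functions of `𝓛`)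
and coefficient functions `s i x ∈ Γ(X, U_x)` of the sections in the local trivialisations (★ `GeneratingSections.CocycleSections`),
tied by the transition rule `s i x|_V = s i y|_V · g_{xy}` (the convention of ★ `GeneratingSections.map_coeffAt_eq`); the morphism is
`D.toProj f` for `D := ofCocycleSections U S hcov` (★ `Motives/GeneratingSectionsOfCocycle`, ★ `Motives/MorphismsToProjectiveSpace`).
★ `Motives/GeneratingSectionsSerreTwistClass` computed the class of the Serre twist `𝒪_X(-n) = serreTwist φ n` (★ `Modules/SerreTwist`)
for the SPECIAL coefficient data `coeffAt` of GLOBAL sections of a framed rank-one module `E` (`[𝒪_X(-n)] = [E]^{-n}`).  This file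
proves the same identity for ARBITRARY cocycle-level data — no module `E`, no global sections —, which is the form met when `𝓛` and
its sections are only given locally (e.g. frames of a push-forward glued by base units, [MumfordFogartyKirwan1994] Prop. 7.4 / Def. 7.5):

* §0 `iSup_basicOpen_coeff_eq_top_iff` — cover criterion for point-indexed coefficient data: the loci `X_{s i y}` cover `X` iff at
  every point `p` some `s i p` is a unit near `p` (locus compatibility).
* §1 **`detClass_serreTwist_toProj_ofCocycleSections`** — `[serreTwist (D.toProj f) n] = ([c]⁻¹)^n` in `Ȟ¹(X, 𝒪_X^×)` (★ `CechPic`):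
  the chart frames of `𝒪_X(-n)` along `φ = D.toProj f` have the cocycle `((x_a/x_b) ∘ φ)^n = (ratio of D)^n` (★ `transitionDet_chartFrame`,
  ★ `map_homRatio_eq_map_chartFun`, ★ `homRatio_toProj`, ★ `ofCocycleSections_ratio_res_mul`), cohomologous to `(g_{yx})^n` through the
  unit coefficients `s (a x) x` on `X_{s (a x) x}`.  ★ `detClass_serreTwist_toProj` is the instance `c := F.cocycle`,
  `S := CocycleSections.ofFrameSystem F h1 t`, `hS := map_coeffAt_eq F h1 t`.
* §2 `nonempty_twistMod_toProj_ofCocycleSections_iso_tensorPow` / `…_iso` — hence `𝒪_X(n) ≅ (lineBundle c)^{⊗n}` and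
  `φ^*𝒪(1) = 𝒪_X(1) ≅ lineBundle c` for the line bundle glued from `c` (★ `Modules/LineBundleOfCocycleClass`: `detClass_lineBundle`;
  ★ `nonempty_iso_iff_detClass_eq`) — II Thm. 7.1 (b) in module form for cocycle-level data.

## References
* [Hartshorne1977] R. Hartshorne, *Algebraic Geometry* (1977), II Thm. 7.1 (p. 150); II Prop. 5.12 (p. 117); II Ex. 5.16 (d);
  III Ex. 4.5 (`Pic X ≅ Ȟ¹(X, 𝒪_X^×)`).
* [GortzWedhorn2020] U. Görtz, T. Wedhorn, *Algebraic Geometry I: Schemes*, 2nd ed. (2020), Prop. 11.15, (11.7), Section (13.8).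
* [MumfordFogartyKirwan1994] D. Mumford, J. Fogarty, F. Kirwan, *Geometric Invariant Theory*, 3rd ed. (1994), Def. 7.5 (p. 130),
  Prop. 7.4 (p. 135) — the consumer (linear rigidifications), not used in the proofs.
-/

noncomputable section

-- `TopCat.Presheaf`/`Scheme.Modules` are not reducible (as in Mathlib's `AlgebraicGeometry/Modules/Sheaf.lean`).
set_option backward.isDefEq.respectTransparency false

universe u

open CategoryTheory AlgebraicGeometry TopologicalSpace Opposite
open Literature.AlgebraicGeometry.Motives Literature.AlgebraicGeometry.Motives.GeneratingSections
open Literature.AlgebraicGeometry.Morphisms Literature.AlgebraicGeometry.Morphisms.ProjCech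

namespace Literature.AlgebraicGeometry.Modules

namespace SerreTwist

/-! ## §0 Cover criterion for point-indexed coefficient data -/

section Cover

variable {X : Scheme.{u}} {ι : Type} {W : X → X.Opens} (mem : ∀ x, x ∈ W x) (S : CocycleSections ι W)

include mem in
/-- A point `p` lies in the locus `⋃_y X_{s i y}` of the `i`-th section iff it lies in `X_{s i p}` (test in the trivialisation at `p`
itself: `X_{s i y} ∩ W_p ⊆ X_{s i p}` by locus compatibility). [cite: Hartshorne1977, II proof of Thm. 7.1] -/
theorem mem_iSup_basicOpen_coeff_iff (i : ι) (p : X) :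
    p ∈ ⨆ y, X.basicOpen (S.coeff i y) ↔ p ∈ X.basicOpen (S.coeff i p) := by
  constructor
  · intro hp
    obtain ⟨y, hy⟩ := Opens.mem_iSup.mp hp
    exact S.locus i y p ⟨hy, mem p⟩
  · intro hp
    exact Opens.mem_iSup.mpr ⟨p, hp⟩

include mem in
/-- **Cover criterion**: the loci of point-indexed coefficient data cover `X` iff at every point `p` some coefficient `s i p` is a
unit near `p` («the sections generate»; the hypothesis of ★ `GeneratingSections.ofCocycleSections`).  The point-indexed analogue of
★ `GeneratingSections.iSup_basicOpen_coeffAt_eq_top_iff`. [cite: Hartshorne1977, II Thm. 7.1 (p. 150)] -/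
theorem iSup_basicOpen_coeff_eq_top_iff :
    ⨆ i, ⨆ y, X.basicOpen (S.coeff i y) = ⊤ ↔ ∀ p : X, ∃ i, p ∈ X.basicOpen (S.coeff i p) := by
  constructor
  · intro htop p
    have hp : p ∈ (⨆ i, ⨆ y, X.basicOpen (S.coeff i y)) := by rw [htop]; trivial
    obtain ⟨i, hi⟩ := Opens.mem_iSup.mp hp
    exact ⟨i, (mem_iSup_basicOpen_coeff_iff mem S i p).mp hi⟩
  · intro hgen
    refine top_le_iff.mp fun p _ => ?_
    obtain ⟨i, hi⟩ := hgen p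
    exact Opens.mem_iSup.mpr ⟨i, Opens.mem_iSup.mpr ⟨p, hi⟩⟩

end Cover

/-! ## §1 The class of `𝒪_X(-n)` along `φ = D.toProj f` for cocycle-level `D` -/

variable {A : Type u} [CommRing A] {r : ℕ} {X : Scheme.{u}} (f : X ⟶ Spec (.of A))
  (c : UnitCocycle X) (S : CocycleSections (Fin (r + 1)) c.U)
  (hS : ∀ (i : Fin (r + 1)) (x y : X) (V : X.Opens) (hx : V ≤ c.U x) (hy : V ≤ c.U y),
    X.presheaf.map (homOfLE hx).op (S.coeff i x) = X.presheaf.map (homOfLE hy).op (S.coeff i y) * c.g x y V hx hy)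
  (hcov : ⨆ i, ⨆ x, X.basicOpen (S.coeff i x) = ⊤)

/-- Two-step restriction of `𝒪_X` equals the one-step restriction. [folklore] -/
private theorem res_res {U V W : X.Opens} (h₁ : V ≤ U) (h₂ : W ≤ V) (s : Γ(X, U)) :
    X.presheaf.map (homOfLE h₂).op (X.presheaf.map (homOfLE h₁).op s) = X.presheaf.map (homOfLE (h₂.trans h₁)).op s := by
  rw [← CommRingCat.comp_apply, ← Functor.map_comp]
  rfl

include hS in
/-- **`[𝒪_X(-n)] = ([c]⁻¹)^n` in `Ȟ¹(X, 𝒪_X^×)`** for `φ = D.toProj f : X → 𝐏ʳ_A` the morphism defined by COCYCLE-LEVEL sections: a unit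
cocycle `c = (U_x, g_{xy})` and coefficients `s i x ∈ Γ(X, U_x)` with `s i x|_V = s i y|_V · g_{xy}` whose loci cover
([Hartshorne1977] II Thm. 7.1 (b) «`φ^*𝒪(1) ≅ 𝓛`», read on classes; II Prop. 5.12 / Ex. 5.16 (d): `𝒪(n)` is glued by `(x_a/x_b)^n`).
The chart frame system of `𝒪_X(-n)` at the chart `a(x)` with `x ∈ X_{s (a x) x}` has transition functions
`((x_{a x}/x_{a y}) ∘ φ)^n = (t_{a x}/t_{a y})^n`, and `t_{a x}/t_{a y} = s (a x) x · g_{yx} · (s (a y) y)⁻¹` on the overlap — a coboundary to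
the `n`-th power of the inverse cocycle `(g_{yx})`.  Arbitrary scheme `X`, arbitrary ring `A`.  ★ `GeneratingSections.detClass_serreTwist_toProj`
is the instance `c := F.cocycle`, `S := CocycleSections.ofFrameSystem F h1 t` (`hS := map_coeffAt_eq F h1 t`).
[cite: Hartshorne1977, II Thm. 7.1 (p. 150)] [cite: Hartshorne1977, II Prop. 5.12 (p. 117)] [cite: Hartshorne1977, III Ex. 4.5] -/
theorem detClass_serreTwist_toProj_ofCocycleSections (n : ℕ) :
    detClass (isFiniteLocallyFree_serreTwist (ofCocycleSections c.U S hcov |>.toProj f : X ⟶ PP A r) n) =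
      ((CechPic.mk c)⁻¹) ^ n := by
  classical
  set D := ofCocycleSections c.U S hcov with hD
  set φ : X ⟶ PP A r := D.toProj f with hφ
  -- chart choice: `x ∈ X_{s_{a x}(x)}` (the sections generate)
  have hgen := (iSup_basicOpen_coeff_eq_top_iff c.mem S).mp hcov
  choose a ha using hgen
  -- `X_{s_b(x)} ≤ U_b = φ⁻¹ D₊(x_b) = Z_b`
  have hUa : ∀ b, D.U b = Zop φ {b} := fun b => by
    rw [Zop_singleton_eq_preU]
    exact (D.toProj_preimage_basicOpen f b).symm
  have hbU : ∀ b x, X.basicOpen (S.coeff b x) ≤ Zop φ {b} := fun b x => by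
    rw [← hUa]; exact basicOpen_le_ofCocycleSections_U c.U _ hcov b x
  -- the chart frame system of `𝒪_X(-n)`
  let G : FrameSystem (serreTwist φ n) :=
    { U := fun x => Zop φ {a x}
      mem := fun x => hbU _ _ (ha x)
      I := fun _ => PUnit.{u + 1}
      rank := fun _ => 1
      enum := fun _ => _root_.Equiv.ofUnique PUnit (Fin 1)
      frame := fun x => freePUnitIso (Zop φ {a x}) ≪≫ (overIsoUnit φ n (a x)).symm }
  have hGg : ∀ (x y : X) (V : X.Opens) (hx : V ≤ Zop φ {a x}) (hy : V ≤ Zop φ {a y}),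
      G.cocycle.g x y V hx hy = X.presheaf.map (homOfLE hy).op (SerreTwist.chartFun φ (a x) (a y)) ^ n :=
    fun x y V hx hy => transitionDet_chartFrame φ n (a x) (a y) hx hy
  -- the `m`-th powers of the inverse cocycle `(g_{yx})`, as cocycles, and their classes
  let cpow : ℕ → UnitCocycle X := fun m =>
    { U := c.U
      mem := c.mem
      g := fun x y V hx hy => c.g y x V hy hx ^ m
      map_g := fun x y V V' hx hy i => by
        change X.presheaf.map (homOfLE i).op (c.g y x V hy hx ^ m) = _
        rw [map_pow]
        exact congrArg (· ^ m) (c.map_g y x hy hx i)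
      g_mul := fun x y z V hx hy hz => by rw [← mul_pow, mul_comm, c.g_mul]
      g_self := fun x V hx => by rw [c.g_self, one_pow] }
  have hc : ∀ m : ℕ, CechPic.mk (cpow m) = ((CechPic.mk c)⁻¹) ^ m := by
    intro m
    induction m with
    | zero =>
      rw [pow_zero, ← CechPic.mk_one]
      exact CechPic.sound (UnitCocycle.equiv_of_eq _ _ c.U c.mem (fun _ => le_rfl) (fun _ => le_top)
        fun x y V hx hy => by change (1 : Γ(X, V)) = c.g y x V _ _ ^ 0; rw [pow_zero])
    | succ m ih =>
      rw [pow_succ, ← ih, ← CechPic.mk_inv, ← CechPic.mk_mul]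
      refine CechPic.sound (UnitCocycle.equiv_of_eq _ _ c.U c.mem (fun _ => le_rfl) (fun _ => le_inf le_rfl le_rfl) ?_)
      intro x y V hx hy
      change c.g y x V _ _ ^ m * c.g y x V _ _ = c.g y x V _ _ ^ (m + 1)
      rw [pow_succ]
  -- the comparison
  rw [detClass_eq_mk _ G, ← hc n]
  refine (CechPic.sound ?_).symm
  -- coboundary `cpow n ~ G.cocycle` on `W x := U_x ∩ X_{s_{a x}(x)}` with `λ_x := s_{a x}(x)^n`
  refine ⟨{ W := fun x => c.U x ⊓ X.basicOpen (S.coeff (a x) x)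
            mem := fun x => ⟨c.mem x, ha x⟩
            le := fun x => inf_le_left
            le' := fun x => inf_le_right.trans (hbU _ _)
            lam := fun x V hV => X.presheaf.map (homOfLE (hV.trans inf_le_left)).op (S.coeff (a x) x) ^ n
            inv := fun x V hV => Ring.inverse (X.presheaf.map (homOfLE (hV.trans inf_le_left)).op (S.coeff (a x) x) ^ n)
            map_lam := fun x V V' hV i => by
              change X.presheaf.map (homOfLE i).op (_ ^ n) = _
              rw [map_pow, res_res]
            lam_mul_inv := fun x V hV => Ring.mul_inverse_cancel _ (IsUnit.pow n ?_)
            rel := fun x y V hx hy => ?_ }⟩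
  · -- `s_{a x}(x)` is a unit on `X_{s_{a x}(x)} ⊇ V`
    have hu := AlgebraicGeometry.Scheme.basicOpen_le X (S.coeff (a x) x)
    have hVb : V ≤ X.basicOpen (S.coeff (a x) x) := hV.trans inf_le_right
    have h₀ : IsUnit (X.presheaf.map (homOfLE hu).op (S.coeff (a x) x)) :=
      RingedSpace.isUnit_res_basicOpen X.toRingedSpace (S.coeff (a x) x)
    have := h₀.map (X.presheaf.map (homOfLE hVb).op).hom
    rwa [res_res] at this
  · -- the coboundary relation `((x_{a x}/x_{a y}) ∘ φ)^n · s_{a y}(y)^n = s_{a x}(x)^n · g_{yx}^n` on `V`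
    change G.cocycle.g x y V _ _ * _ ^ n = _ ^ n * c.g y x V _ _ ^ n
    rw [hGg, ← mul_pow, ← mul_pow]
    congr 1
    -- (i) the chart function is the ratio `t_{a x}/t_{a y}` of `D`
    have hVy : V ≤ X.basicOpen (S.coeff (a y) y) := hy.trans inf_le_right
    have hVUy : V ≤ D.U (a y) := hVy.trans (basicOpen_le_ofCocycleSections_U c.U _ hcov (a y) y)
    have hVpre : V ≤ preU φ (a y) := by rw [← Zop_singleton_eq_preU, ← hUa]; exact hVUy
    have e1 : X.presheaf.map (homOfLE (hy.trans (inf_le_right.trans (hbU _ _)))).op (SerreTwist.chartFun φ (a x) (a y)) =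
        X.presheaf.map (homOfLE hVUy).op (D.ratio (a y) (a x)) := by
      rw [← map_homRatio_eq_map_chartFun φ (a y) (a x) hVpre, homRatio_toProj, res_res]
    -- (ii) `ratio (a y) (a x) · s_{a y}(y) = s_{a x}(y)` on `X_{s_{a y}(y)} ⊇ V`
    have hVFy : V ≤ c.U y := hy.trans inf_le_left
    have hVFx : V ≤ c.U x := hx.trans inf_le_left
    have e2 : X.presheaf.map (homOfLE hVUy).op (D.ratio (a y) (a x)) *
        X.presheaf.map (homOfLE hVFy).op (S.coeff (a y) y) =
        X.presheaf.map (homOfLE hVFy).op (S.coeff (a x) y) := by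
      have h := congrArg (X.presheaf.map (homOfLE hVy).op)
        (ofCocycleSections_ratio_res_mul c.U S hcov (a y) (a x) y)
      rw [map_mul] at h
      simp only [← CommRingCat.comp_apply, ← Functor.map_comp] at h
      exact h
    -- (iii) `s_{a x}(y) = s_{a x}(x) · g_{yx}` on `V` (the transition rule `hS` at `(y, x)`)
    have e3 := hS (a x) y x V hVFy hVFx
    rw [e1, e2, e3]

/-! ## §2 `𝒪_X(n) ≅ (lineBundle c)^{⊗n}` -/

include hS in
/-- **[Hartshorne1977] II Thm. 7.1 (b), MODULE FORM for cocycle-level data: `𝒪_X(n) ≅ (lineBundle c)^{⊗n}`** — for `φ = D.toProj f` the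
morphism defined by the unit cocycle `c` and coefficients `s` as in `detClass_serreTwist_toProj_ofCocycleSections`, the Serre twist
`𝒪_X(n) = twistMod φ 𝒪_X n` (the dual of `𝒪_X(-n)`, ★ `sheafHomTwistIso`) is isomorphic to the `n`-th tensor power of the line bundle
glued from `c` (★ `lineBundle c`, ★ `detClass_lineBundle : [lineBundle c] = [c]`): both have rank one and class `[c]^n` (§1, ★ `detClass_dual`,
★ `detClass_tensorPow`, ★ `nonempty_iso_iff_detClass_eq`).  Arbitrary scheme `X`.
[cite: Hartshorne1977, II Thm. 7.1 (p. 150)] [cite: Hartshorne1977, III Ex. 4.5] -/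
theorem nonempty_twistMod_toProj_ofCocycleSections_iso_tensorPow (n : ℕ) :
    Nonempty (twistMod (ofCocycleSections c.U S hcov |>.toProj f : X ⟶ PP A r) (unitModule X) n ≅
      tensorPow (lineBundle c) n) := by
  set φ : X ⟶ PP A r := (ofCocycleSections c.U S hcov).toProj f with hφ
  have hE1 : HasRank (lineBundle c) 1 := c.hasRank_lineBundle
  have hE : IsFiniteLocallyFree (lineBundle c) := c.isFiniteLocallyFree_lineBundle
  have hT := isFiniteLocallyFree_serreTwist φ n
  have hTd := isFiniteLocallyFree_dual hT
  obtain ⟨e⟩ : Nonempty (Modules.dual (serreTwist φ n) ≅ tensorPow (lineBundle c) n) := by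
    refine (nonempty_iso_iff_detClass_eq (hasRank_dual (hasRank_serreTwist φ n)) (hasRank_tensorPow_one hE1 n) hTd
      (isFiniteLocallyFree_tensorPow hE n)).2 ?_
    rw [detClass_dual hT, detClass_serreTwist_toProj_ofCocycleSections f c S hS hcov n, detClass_tensorPow hE1 hE n, inv_pow,
      inv_inv, detClass_congr hE c.isFiniteLocallyFree_lineBundle, c.detClass_lineBundle]
  exact ⟨(sheafHomTwistIso φ (unitModule X) n).symm ≪≫ e⟩

include hS in
/-- **`φ^*𝒪(1) = 𝒪_X(1) ≅ lineBundle c`** for the morphism `φ = D.toProj f` defined by cocycle-level sections with unit cocycle `c`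
(the case `n = 1`: `(lineBundle c)^{⊗1} = lineBundle c ⊗ 𝒪 ≅ lineBundle c`; [Hartshorne1977] II Thm. 7.1 (b)).
[cite: Hartshorne1977, II Thm. 7.1 (p. 150)] [cite: Hartshorne1977, III Ex. 4.5] -/
theorem nonempty_twistMod_toProj_ofCocycleSections_iso :
    Nonempty (twistMod (ofCocycleSections c.U S hcov |>.toProj f : X ⟶ PP A r) (unitModule X) 1 ≅ lineBundle c) := by
  set φ : X ⟶ PP A r := (ofCocycleSections c.U S hcov).toProj f with hφ
  have hE1 : HasRank (lineBundle c) 1 := c.hasRank_lineBundle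
  have hE : IsFiniteLocallyFree (lineBundle c) := c.isFiniteLocallyFree_lineBundle
  have hT := isFiniteLocallyFree_serreTwist φ 1
  have hTd := isFiniteLocallyFree_dual hT
  obtain ⟨e⟩ : Nonempty (Modules.dual (serreTwist φ 1) ≅ lineBundle c) := by
    refine (nonempty_iso_iff_detClass_eq (hasRank_dual (hasRank_serreTwist φ 1)) hE1 hTd hE).2 ?_
    rw [detClass_dual hT, detClass_serreTwist_toProj_ofCocycleSections f c S hS hcov 1, pow_one, inv_inv,
      detClass_congr hE c.isFiniteLocallyFree_lineBundle, c.detClass_lineBundle]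
  exact ⟨(sheafHomTwistIso φ (unitModule X) 1).symm ≪≫ e⟩

end SerreTwist

end Literature.AlgebraicGeometry.Modules

end
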